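import Summits.BirchSwinnertonDyer.BirchSwinnertonDyer.Theorems.CMKolyvaginAtInertTwoAdaptiveTelescopeAtTwo
import Summits.BirchSwinnertonDyer.BirchSwinnertonDyer.Theorems.ErratumRoadFiveShimuraKolyvaginOrderBoundInertShiftCebotarev
import Summits.BirchSwinnertonDyer.BirchSwinnertonDyer.Theorems.GenusKolyvaginAtTwoVisiblePairAtTwoInjective
import Literature.NumberTheory.EllipticCurves.HeegnerPointsKolyvaginPrimaryLocalTrivialProofs
import Literature.NumberTheory.EllipticCurves.BSDSelmerCMPConverseHeegnerFieldProofs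
import Literature.NumberTheory.EllipticCurves.NonEisensteinPrimeOfSurjective
import HarnessLib

/-!
# Route `CMKolyvaginAtInertTwo`, crux `CMKolyvaginExactAtInertTwo` (stmt-BirchSwinnertonDyer-24277):
# T4c ONE LEVEL DEEPER — the Čebotarev binder with Kolyvagin primes of depth `M+1` for classes of
# level `2^M`, and the adaptive telescope with depth-`(M+1)` Kolyvagin primes

Seat `bsd-line-cmk2-p1` g14 (cell `bsd-print-cf2`); helper (`--supports stmt-BirchSwinnertonDyer-24277`).
THEOREMS ONLY: no definition, no named fact, no `sorry`; no item is closed; BSD is not proved by this.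

The T2 design (KERNEL-STATUS §13.2) runs McCallum's induction on a `ℚ`-Selmer sub-carrier whose
Kolyvagin primes are Gross-form primes of DEPTH `M+1` (`Frob ℓ = Frob ∞` on `E[2^{M+1}]`), while the
classes stay at level `2^M`: the genus component of a Kolyvagin class dies one level deeper
(`Literature…KolyvaginClassLevelChange`). The binder `cebotarev_binder_pair` (p671475) at level `M`
only produces primes of depth `M`. Here it is applied at level `M+1` to the images of the level-`M`
classes under the change of level `ι_* : H¹(K, E[2^M]) → H¹(K, E[2^{M+1}])` (`torsionH1OfDvd`), on
the pair `V_M = H¹(K,E[2^M])^{ε} × H¹(K,E[2^M])^{−ε} → V_{M+1}`: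

* `ι_*` commutes with `c_*` (`conjAct_torsionH1OfDvd`), so it maps eigengroups to eigengroups, and a
  pair map `ι : V_M →+ V_{M+1}` exists (`exists_pairLift`; no new definition — an existence statement);
* `ι_*` is injective over `K` (`E(K)[2] = 0` from `ρ̄_{E,2}` onto and `[K:ℚ] = 2`), hence `ι`
  preserves orders, eigengroup membership (both ways), and `Δ = ker(u,v ↦ u+v)` (both ways) — so the
  binder's hypotheses `H1`, `H2` TRANSFER from level `M` to level `M+1`;
* at a Kolyvagin prime `ℓ` of depth `M+1`, `Γ_{K_λ}` fixes `E[2^{M+1}]`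
  (`absGaloisRestrict_smul_geomTorsion_eq_of_kolyvaginPrime_pow`, good reduction from a Heegner
  point of level `N`), so `t_λ = 0 ⟺ (ι t)_λ = 0` (`mem_torsionLocalKer_iff_torsionH1OfDvd_mem`) and
  the binder's CONCLUSIONS transfer back: `cebotarev_binder_pair_succ`;
* `card_mul_card_le_two_pow_of_pair_succ` — the adaptive telescope (McCallum Thm. 5.4 "≤" at
  `p = 2`) for ANY `Sd : SplitDataM (PairV W c M ε) (Places K)` whose Kolyvagin primes are the
  Gross-form primes of depth `M+1` with `S ℓ` (`Sd.Kol ℓ ↔ Kolyvagin ∧ FrobEqFrobInfty (2^{M+1}) ℓ ∧ S ℓ`).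

References: [McCallumLMS1991] §3 (2), (3), Prop. 3.1, Cor. 3.2; §4 (5), Lemma 4.6; §5 Thm. 5.4;
[GrossLMS1991] §9, Prop. 9.6; [Kolyvagin1989Izv] §3.
-/

-- single-conjunct summit: `Summit.BirchSwinnertonDyer.BirchSwinnertonDyer.…` repeats the name by design
set_option linter.dupNamespace false
set_option autoImplicit false

noncomputable section

open scoped Classical
open WeierstrassCurve NumberField IsDedekindDomain Field
open Literature.NumberTheory.GaloisRepresentations
open Literature.NumberTheory.EllipticCurves Literature.NumberTheory.EllipticCurves.KolyvaginDescent

namespace Summit.BirchSwinnertonDyer.BirchSwinnertonDyer.Theorems.KolyvaginPairDataTwo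

open KolyvaginAdaptiveData

variable {N : ℕ} (W : WeierstrassCurve ℚ) {K : Type} [Field K] [NumberField K] (c : K ≃ₐ[ℚ] K) (M : ℕ)

/-! ## The change of level `ι_*` on the eigengroups and on the pair -/

/-- `2^M ∣ 2^{M+1}` in `ℤ`. [folklore] -/
theorem two_pow_dvd_two_pow_succ : ((2 ^ M : ℕ) : ℤ) ∣ ((2 ^ (M + 1) : ℕ) : ℤ) :=
  Int.natCast_dvd_natCast.mpr (pow_dvd_pow 2 (Nat.le_succ M))

/-- `ι_*` maps the `ν`-eigengroup of `c_*` at level `2^M` into the one at level `2^{M+1}`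
(`c_* ι_* = ι_* c_*`). [cite: GrossLMS1991, §5 (5.1)] -/
theorem torsionH1OfDvd_mem_eigK (ν : ℤ) {g : galH1Torsion (W.baseChange K) ((2 ^ M : ℕ) : ℤ)}
    (hg : g ∈ eigK W c M ν) :
    torsionH1OfDvd (W.baseChange K) (two_pow_dvd_two_pow_succ M) g ∈ eigK W c (M + 1) ν := by
  rw [mem_eigK_iff] at hg ⊢
  rw [conjAct_torsionH1OfDvd W c (two_pow_dvd_two_pow_succ M) g, hg, map_zsmul]

/-- **The pair map `ι : V_M → V_{M+1}`** (componentwise `ι_*`), as an existence statement.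
[cite: Kolyvagin1989Izv, §3] -/
theorem exists_pairLift (ε : ℤ) :
    ∃ ι : PairV W c M ε →+ PairV W c (M + 1) ε,
      (∀ v, ((ι v).1 : galH1Torsion (W.baseChange K) ((2 ^ (M + 1) : ℕ) : ℤ)) =
        torsionH1OfDvd (W.baseChange K) (two_pow_dvd_two_pow_succ M) (v.1 : galH1Torsion _ _)) ∧
      (∀ v, ((ι v).2 : galH1Torsion (W.baseChange K) ((2 ^ (M + 1) : ℕ) : ℤ)) =
        torsionH1OfDvd (W.baseChange K) (two_pow_dvd_two_pow_succ M) (v.2 : galH1Torsion _ _)) :=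
  ⟨AddMonoidHom.prodMap
      (((torsionH1OfDvd (W.baseChange K) (two_pow_dvd_two_pow_succ M)).comp
          (eigK W c M ε).subtype).codRestrict (eigK W c (M + 1) ε)
        (fun g ↦ torsionH1OfDvd_mem_eigK W c M ε g.2))
      (((torsionH1OfDvd (W.baseChange K) (two_pow_dvd_two_pow_succ M)).comp
          (eigK W c M (-ε)).subtype).codRestrict (eigK W c (M + 1) (-ε))
        (fun g ↦ torsionH1OfDvd_mem_eigK W c M (-ε) g.2)),
    fun _ ↦ rfl, fun _ ↦ rfl⟩

/-- **`ι_* : H¹(K, E[2^M]) → H¹(K, E[2^{M+1}])` is injective** for `K` imaginary quadratic and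
`ρ̄_{E,2}` onto (`E(K)[2] = 0`). [cite: McCallumLMS1991, §4 (5)] -/
theorem torsionH1OfDvd_succ_injective [W.IsElliptic] (hK : IsImaginaryQuadratic K)
    (hρ : W.HasSurjectiveModNGaloisRep 2) :
    Function.Injective (torsionH1OfDvd (W.baseChange K) (two_pow_dvd_two_pow_succ M)) := by
  haveI : (W.baseChange K).IsElliptic := inferInstanceAs (W.map (algebraMap ℚ K)).IsElliptic
  haveI : Fact (Nat.Prime 2) := ⟨Nat.prime_two⟩
  have hirr : W.HasIrreducibleModPGaloisRep 2 :=
    hasIrreducibleModPGaloisRep_of_hasSurjectiveModNGaloisRep W 2 hρ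
  have hbot := torsionBy_eq_bot_of_isImaginaryQuadratic_of_hasIrreducibleModPGaloisRep W K hK
    Nat.prime_two hirr
  exact GenusExact.VisiblePairAtTwo.torsionH1OfDvd_pow_injective (W.baseChange K) (p := 2) (a := M)
    (j := M + 1) hbot (two_pow_dvd_two_pow_succ M)

section Lift

variable {W c M} {ε : ℤ} {ι : PairV W c M ε →+ PairV W c (M + 1) ε}
  (hι₁ : ∀ v, ((ι v).1 : galH1Torsion (W.baseChange K) ((2 ^ (M + 1) : ℕ) : ℤ)) =
    torsionH1OfDvd (W.baseChange K) (two_pow_dvd_two_pow_succ M) (v.1 : galH1Torsion _ _))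
  (hι₂ : ∀ v, ((ι v).2 : galH1Torsion (W.baseChange K) ((2 ^ (M + 1) : ℕ) : ℤ)) =
    torsionH1OfDvd (W.baseChange K) (two_pow_dvd_two_pow_succ M) (v.2 : galH1Torsion _ _))
  (hinj : Function.Injective (torsionH1OfDvd (W.baseChange K) (two_pow_dvd_two_pow_succ M)))
include hι₁ hι₂ hinj

omit hι₂ in
/-- `(ι v).1 = 0 ↔ v.1 = 0` for injective `ι_*`. [folklore] -/
theorem pairLift_fst_eq_zero_iff (v : PairV W c M ε) : (ι v).1 = 0 ↔ v.1 = 0 := by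
  rw [← Subtype.coe_inj, hι₁, ZeroMemClass.coe_zero, ← Subtype.coe_inj, ZeroMemClass.coe_zero,
    ← map_zero (torsionH1OfDvd (W.baseChange K) (two_pow_dvd_two_pow_succ M))]
  exact hinj.eq_iff

omit hι₁ in
/-- `(ι v).2 = 0 ↔ v.2 = 0` for injective `ι_*`. [folklore] -/
theorem pairLift_snd_eq_zero_iff (v : PairV W c M ε) : (ι v).2 = 0 ↔ v.2 = 0 := by
  rw [← Subtype.coe_inj, hι₂, ZeroMemClass.coe_zero, ← Subtype.coe_inj, ZeroMemClass.coe_zero,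
    ← map_zero (torsionH1OfDvd (W.baseChange K) (two_pow_dvd_two_pow_succ M))]
  exact hinj.eq_iff

/-- `ι v = 0 ↔ v = 0` (so the pair map `ι` is injective). [folklore] -/
theorem pairLift_eq_zero_iff (v : PairV W c M ε) : ι v = 0 ↔ v = 0 := by
  constructor
  · intro h
    have h1 : (ι v).1 = 0 := by rw [h]; rfl
    have h2 : (ι v).2 = 0 := by rw [h]; rfl
    rw [pairLift_fst_eq_zero_iff hι₁ hinj] at h1
    rw [pairLift_snd_eq_zero_iff hι₂ hinj] at h2
    exact Prod.ext h1 h2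
  · rintro rfl
    exact map_zero ι

/-- `ι` respects the eigengroups of the pair, both ways. [cite: Kolyvagin1989Izv, §3] -/
theorem pairLift_mem_pairEig_iff (e : ℤ) (v : PairV W c M ε) :
    ι v ∈ pairEig W c (M + 1) ε e ↔ v ∈ pairEig W c M ε e := by
  by_cases h1 : e = ε
  · rw [h1, pairEig_self, pairEig_self, AddSubgroup.mem_prod, AddSubgroup.mem_prod,
      AddSubgroup.mem_bot, AddSubgroup.mem_bot, pairLift_snd_eq_zero_iff hι₂ hinj]
    exact ⟨fun h ↦ ⟨AddSubgroup.mem_top _, h.2⟩, fun h ↦ ⟨AddSubgroup.mem_top _, h.2⟩⟩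
  by_cases h2 : e = -ε
  · rw [pairEig, if_neg h1, if_pos h2, pairEig, if_neg h1, if_pos h2, AddSubgroup.mem_prod,
      AddSubgroup.mem_prod, AddSubgroup.mem_bot, AddSubgroup.mem_bot,
      pairLift_fst_eq_zero_iff hι₁ hinj]
    exact ⟨fun h ↦ ⟨h.1, AddSubgroup.mem_top _⟩, fun h ↦ ⟨h.1, AddSubgroup.mem_top _⟩⟩
  · rw [pairEig, if_neg h1, if_neg h2, pairEig, if_neg h1, if_neg h2, AddSubgroup.mem_bot,
      AddSubgroup.mem_bot]
    exact pairLift_eq_zero_iff hι₁ hι₂ hinj v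

/-- `ι` respects `Δ = ker (u, v) ↦ u + v`, both ways. [cite: Kolyvagin1989Izv, §3] -/
theorem pairLift_mem_pairDelta_iff (v : PairV W c M ε) :
    ι v ∈ pairDelta W c (M + 1) ε ↔ v ∈ pairDelta W c M ε := by
  rw [mem_pairDelta_iff, mem_pairDelta_iff, hι₁, hι₂, ← map_add,
    ← map_zero (torsionH1OfDvd (W.baseChange K) (two_pow_dvd_two_pow_succ M))]
  exact hinj.eq_iff

omit hinj in
/-- **The strict condition transfers along `ι`** at a Kolyvagin prime `ℓ` whose local Galois group
fixes `E[2^{M+1}]`: `v ∈ pairA_M ℓ ↔ ι v ∈ pairA_{M+1} ℓ`. [cite: McCallumLMS1991, §3 (3), §4]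
[cite: GrossLMS1991, Prop. 9.6] -/
theorem mem_pairA_iff_pairLift_mem [NeZero N] [W.IsElliptic] {ℓ : ℕ} (hℓ : IsKolyvaginPrime N W K 2 ℓ)
    (htriv : ∀ (g : absoluteGaloisGroup (hℓ.place.adicCompletion K))
      (Q : geomTorsion (W.baseChange K) ((2 ^ (M + 1) : ℕ) : ℤ)),
      resGal (K := K) (hℓ.place.adicCompletion K) g • Q = Q)
    (v : PairV W c M ε) :
    v ∈ pairA (N := N) W c M ε ℓ ↔ ι v ∈ pairA (N := N) W c (M + 1) ε ℓ := by
  haveI : (W.baseChange K).IsElliptic := inferInstanceAs (W.map (algebraMap ℚ K)).IsElliptic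
  have hdn : 2 ^ M ∣ 2 ^ (M + 1) := pow_dvd_pow 2 (Nat.le_succ M)
  have hd : 2 ^ M ≠ 0 := pow_ne_zero _ two_ne_zero
  have hn : 2 ^ (M + 1) ≠ 0 := pow_ne_zero _ two_ne_zero
  rw [mem_pairA_iff W c M hℓ, mem_pairA_iff W c (M + 1) hℓ, hι₁, hι₂,
    mem_torsionLocalKer_iff_torsionH1OfDvd_mem (W.baseChange K) (hℓ.place.adicCompletion K) hdn hd hn
      htriv,
    mem_torsionLocalKer_iff_torsionH1OfDvd_mem (W.baseChange K) (hℓ.place.adicCompletion K) hdn hd hn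
      htriv]

end Lift

/-! ## The binder one level deeper -/

-- the product-of-subtypes carrier `PairV` makes instance unification slow (`addOrderOf`, `•`)
set_option maxHeartbeats 800000 in
/-- **T4c with Kolyvagin primes of depth `M+1` for classes of level `2^M`.** Same statement as
`cebotarev_binder_pair` (the hypothesis `hCeb₂` of the adaptive telescope, exponent form), except
that the Cartan inputs `hcomm`, `m₀` are taken at level `2^{M+1}`, a Heegner point of level `N` is
given (good reduction at Kolyvagin primes), and the Kolyvagin prime produced has DEPTH `M+1`:
`Frob ℓ = Frob ∞` on `E[2^{M+1}]`. Proof: `cebotarev_binder_pair` at level `M+1` for the images under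
`ι : V_M → V_{M+1}`; the hypotheses transfer by injectivity of `ι_*`, the conclusions by
`E(K_λ)[2^{M+1}] = E[2^{M+1}]`. [cite: McCallumLMS1991, §3 (2), (3), Prop. 3.1, Cor. 3.2; §4 (5), Lemma 4.6]
[cite: GrossLMS1991, §9 (Props. 9.3, 9.6)] -/
theorem cebotarev_binder_pair_succ
    (hC : Literature.NumberTheory.Automorphic.chebotarev_artinRep)
    [NeZero N] [W.IsElliptic] (hK : IsImaginaryQuadratic K) (hρ : W.HasSurjectiveModNGaloisRep 2)
    (hΔK : ¬ IsSquare (W.baseChange K).Δ) (hc : c ≠ 1)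
    {c₀ : absoluteGaloisGroup ℚ} (hc₀ : IsComplexConjugation (Rat.castHom ℝ) c₀)
    {z : absoluteGaloisGroup K}
    (hzfix : ∀ P : geomTorsion (W.baseChange K) ((2 : ℕ) : ℤ), z • P = P → P = 0)
    (hcomm : ∀ π ∈ torsionFixing (W.baseChange K) ((2 : ℕ) : ℤ),
      ∀ P : geomTorsion (W.baseChange K) ((2 ^ (M + 1) : ℕ) : ℤ), π • z • P = z • π • P)
    {S : ℕ → Prop}
    (hS : ∀ ℓ, IsKolyvaginPrime N W K 2 ℓ → FrobEqFrobInfty W K (2 ^ (M + 1)) ℓ → S ℓ)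
    (m₀ : geomTorsion (W.baseChange K) ((2 ^ (M + 1) : ℕ) : ℤ))
    (hm : ∀ s : ℤ, s = 1 ∨ s = -1 → ∀ k : ℤ,
      k • (m₀ + s • (RatClosure.isLiftOfAut_absGaloisTransport_of_isImaginaryQuadratic hK hc hc₀).torsionMap
        W ((2 ^ (M + 1) : ℕ) : ℤ) m₀) = 0 → ((2 ^ (M + 1) : ℕ) : ℤ) ∣ k)
    {P₀ : (W.baseChange K).toAffine.Point} (hP₀ : IsHeegnerPoint N W K P₀)
    {ε : ℤ} (hε : ε = 1 ∨ ε = -1)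
    (T : Finset (PairV W c M ε)) (g₁ g₂ : PairV W c M ε) (ν : ℤ) (I e₁ : ℕ) (hν : ν = 1 ∨ ν = -1)
    (hg₁ : g₁ ∈ pairEig W c M ε ν) (hg₂ : g₂ ∈ pairEig W c M ε (-ν))
    (hT : ∀ t ∈ T, ∃ e : ℤ, (e = 1 ∨ e = -1) ∧ t ∈ pairEig W c M ε e)
    (he₁ : addOrderOf g₁ = 2 ^ e₁)
    (H1 : g₁ ≠ 0 → (((2 : ℕ) : ℤ) ^ (e₁ - 1)) • g₁ ∉
      pairDelta W c M ε ⊔ AddSubgroup.closure (T : Set (PairV W c M ε)))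
    (H2 : 1 ≤ I → ∀ d ∈ pairDelta W c M ε, ∀ u ∈ AddSubgroup.closure (T : Set (PairV W c M ε)),
      u ∈ pairEig W c M ε (-ν) → ∀ v ∈ AddSubgroup.closure (T : Set (PairV W c M ε)),
      v ∈ pairEig W c M ε ν → ((2 : ℕ) : ℤ) • v = 0 → (((2 : ℕ) : ℤ) ^ (I - 1)) • g₂ ≠ d + u + v)
    (b₀ : ℕ) :
    ∃ ℓ : ℕ, b₀ < ℓ ∧ (IsKolyvaginPrime N W K 2 ℓ ∧ FrobEqFrobInfty W K (2 ^ (M + 1)) ℓ ∧ S ℓ) ∧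
      (∀ t ∈ AddSubgroup.closure (T : Set (PairV W c M ε)), t ∈ pairA (N := N) W c M ε ℓ) ∧
      (∀ j < e₁, (((2 : ℕ) : ℤ) ^ j) • g₁ ∉ pairA (N := N) W c M ε ℓ) ∧
      (∀ i < I, (((2 : ℕ) : ℤ) ^ i) • g₂ ∉ pairA (N := N) W c M ε ℓ) := by
  obtain ⟨ι, hι₁, hι₂⟩ := exists_pairLift W c M ε
  have hinjH := torsionH1OfDvd_succ_injective W M hK hρ
  have hinj : Function.Injective ι :=
    (injective_iff_map_eq_zero ι).mpr fun v hv ↦ (pairLift_eq_zero_iff hι₁ hι₂ hinjH v).mp hv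
  -- ### the transferred data at level `M+1`
  have hclos : AddSubgroup.closure ((T.image ι : Finset (PairV W c (M + 1) ε)) : Set (PairV W c (M + 1) ε)) =
      (AddSubgroup.closure (T : Set (PairV W c M ε))).map ι := by
    rw [Finset.coe_image, AddMonoidHom.map_closure]
  have hT' : ∀ t ∈ T.image ι, ∃ e : ℤ, (e = 1 ∨ e = -1) ∧ t ∈ pairEig W c (M + 1) ε e := by
    intro t ht
    obtain ⟨s, hs, rfl⟩ := Finset.mem_image.mp ht
    obtain ⟨e, he, hse⟩ := hT s hs
    exact ⟨e, he, (pairLift_mem_pairEig_iff hι₁ hι₂ hinjH e s).mpr hse⟩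
  have hg₁' : ι g₁ ∈ pairEig W c (M + 1) ε ν := (pairLift_mem_pairEig_iff hι₁ hι₂ hinjH ν g₁).mpr hg₁
  have hg₂' : ι g₂ ∈ pairEig W c (M + 1) ε (-ν) :=
    (pairLift_mem_pairEig_iff hι₁ hι₂ hinjH (-ν) g₂).mpr hg₂
  have he₁' : addOrderOf (ι g₁) = 2 ^ e₁ := by rw [addOrderOf_injective ι hinj, he₁]
  have H1' : ι g₁ ≠ 0 → (((2 : ℕ) : ℤ) ^ (e₁ - 1)) • ι g₁ ∉
      pairDelta W c (M + 1) ε ⊔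
        AddSubgroup.closure ((T.image ι : Finset (PairV W c (M + 1) ε)) : Set (PairV W c (M + 1) ε)) := by
    intro hne hmem
    have hne0 : g₁ ≠ 0 := fun h ↦ hne (by rw [h, map_zero])
    rw [hclos] at hmem
    obtain ⟨d', hd', w', hw', hsum⟩ := AddSubgroup.mem_sup.mp hmem
    obtain ⟨w, hw, rfl⟩ := AddSubgroup.mem_map.mp hw'
    have hd'eq : d' = ι ((((2 : ℕ) : ℤ) ^ (e₁ - 1)) • g₁ - w) := by
      rw [map_sub, map_zsmul, ← hsum, add_sub_cancel_right]
    have hd : (((2 : ℕ) : ℤ) ^ (e₁ - 1)) • g₁ - w ∈ pairDelta W c M ε := by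
      rw [← pairLift_mem_pairDelta_iff hι₁ hι₂ hinjH, ← hd'eq]
      exact hd'
    exact H1 hne0 (AddSubgroup.mem_sup.mpr ⟨_, hd, w, hw, sub_add_cancel _ _⟩)
  have H2' : 1 ≤ I → ∀ d' ∈ pairDelta W c (M + 1) ε,
      ∀ u' ∈ AddSubgroup.closure ((T.image ι : Finset (PairV W c (M + 1) ε)) : Set (PairV W c (M + 1) ε)),
      u' ∈ pairEig W c (M + 1) ε (-ν) →
      ∀ v' ∈ AddSubgroup.closure ((T.image ι : Finset (PairV W c (M + 1) ε)) : Set (PairV W c (M + 1) ε)),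
      v' ∈ pairEig W c (M + 1) ε ν → ((2 : ℕ) : ℤ) • v' = 0 →
      (((2 : ℕ) : ℤ) ^ (I - 1)) • ι g₂ ≠ d' + u' + v' := by
    intro hI d' hd' u' hu' hu'ν v' hv' hv'ν h2v' heq
    rw [hclos] at hu' hv'
    obtain ⟨u, hu, rfl⟩ := AddSubgroup.mem_map.mp hu'
    obtain ⟨v, hv, rfl⟩ := AddSubgroup.mem_map.mp hv'
    have huν : u ∈ pairEig W c M ε (-ν) := (pairLift_mem_pairEig_iff hι₁ hι₂ hinjH (-ν) u).mp hu'ν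
    have hvν : v ∈ pairEig W c M ε ν := (pairLift_mem_pairEig_iff hι₁ hι₂ hinjH ν v).mp hv'ν
    have h2v : ((2 : ℕ) : ℤ) • v = 0 := by
      apply hinj
      rw [map_zsmul, h2v', map_zero]
    have hd'eq : d' = ι ((((2 : ℕ) : ℤ) ^ (I - 1)) • g₂ - u - v) := by
      rw [map_sub, map_sub, map_zsmul, heq]; abel
    have hd : (((2 : ℕ) : ℤ) ^ (I - 1)) • g₂ - u - v ∈ pairDelta W c M ε := by
      rw [← pairLift_mem_pairDelta_iff hι₁ hι₂ hinjH, ← hd'eq]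
      exact hd'
    exact H2 hI _ hd u hu huν v hv hvν h2v (by abel)
  -- ### the binder at level `M+1`
  have hM' : 1 ≤ M + 1 := Nat.le_add_left 1 M
  obtain ⟨ℓ, hbℓ, ⟨hkol, hfrob, hSℓ⟩, hpool, hfull, hge⟩ :=
    cebotarev_binder_pair hC W hK hρ hΔK hc hc₀ hM' hzfix hcomm hS m₀ hm hε (T.image ι) (ι g₁) (ι g₂)
      ν I e₁ hν hg₁' hg₂' hT' he₁' H1' H2' b₀
  -- ### back to level `M`: `Γ_{K_λ}` fixes `E[2^{M+1}]`
  have htriv : ∀ (g : absoluteGaloisGroup (hkol.place.adicCompletion K))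
      (Q : geomTorsion (W.baseChange K) ((2 ^ (M + 1) : ℕ) : ℤ)),
      resGal (K := K) (hkol.place.adicCompletion K) g • Q = Q := fun g Q ↦
    absGaloisRestrict_smul_geomTorsion_eq_of_kolyvaginPrime_pow W hK hP₀ Nat.prime_two hkol (M + 1)
      hfrob g Q
  refine ⟨ℓ, hbℓ, ⟨hkol, hfrob, hSℓ⟩, ?_, ?_, ?_⟩
  · intro t ht
    rw [mem_pairA_iff_pairLift_mem hι₁ hι₂ hkol htriv]
    exact hpool (ι t) (by rw [hclos]; exact AddSubgroup.mem_map_of_mem ι ht)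
  · intro j hj hmem
    refine hfull j hj ?_
    rw [← map_zsmul, ← mem_pairA_iff_pairLift_mem hι₁ hι₂ hkol htriv]
    exact hmem
  · intro i hi hmem
    refine hge i hi ?_
    rw [← map_zsmul, ← mem_pairA_iff_pairLift_mem hι₁ hι₂ hkol htriv]
    exact hmem

/-! ## The adaptive telescope with Kolyvagin primes of depth `M+1` -/

/-- **McCallum Thm. 5.4 "≤" at `p = 2` on the pair currency with Kolyvagin primes ONE LEVEL DEEPER.**
Same statement as `card_mul_card_le_two_pow_of_pair` (p679105) for split descent data `Sd` on
`V = H¹(K,E[2^M])^{ε} × H¹(K,E[2^M])^{−ε}` with `Sd.eig = pairEig`, `Sd.A = pairA`, `Sd.p = 2`, except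
that the data's Kolyvagin primes are the Gross-form primes of DEPTH `M+1` with `S ℓ`
(`Sd.Kol ℓ ↔ Kolyvagin ∧ Frob ℓ = Frob ∞ on E[2^{M+1}] ∧ S ℓ` — the `ℚ`-Selmer sub-carrier of
KERNEL-STATUS §13.2), the Cartan input `hcomm` is at level `2^{M+1}`, and a Heegner point of level `N`
is given. GIVEN the Cassels–Tate value formula `hCTV` for `Sd` and finite isotropic lift groups
`Zp`, `Zm` with `hind`, (IND) `hIND` and room, **`#Zp · #Zm ≤ 2^{M₀}`**.
[cite: McCallumLMS1991, §1 Theorem; §5 Thm. 5.4, Cor. 5.6; §3 Prop. 3.1, Cor. 3.2; §4 Lemma 4.6]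
[cite: GrossLMS1991, §9] -/
theorem card_mul_card_le_two_pow_of_pair_succ (hC : Literature.NumberTheory.Automorphic.chebotarev_artinRep)
    [NeZero N] [W.IsElliptic] (hK : IsImaginaryQuadratic K) (hρ : W.HasSurjectiveModNGaloisRep 2)
    (hΔ : W.Δ < 0) (hΔK : ¬ IsSquare (W.baseChange K).Δ) (hc : c ≠ 1)
    {c₀ : absoluteGaloisGroup ℚ} (hc₀ : IsComplexConjugation (Rat.castHom ℝ) c₀)
    {z : absoluteGaloisGroup K}
    (hzfix : ∀ P : geomTorsion (W.baseChange K) ((2 : ℕ) : ℤ), z • P = P → P = 0)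
    (hcomm : ∀ π ∈ torsionFixing (W.baseChange K) ((2 : ℕ) : ℤ),
      ∀ P : geomTorsion (W.baseChange K) ((2 ^ (M + 1) : ℕ) : ℤ), π • z • P = z • π • P)
    {S : ℕ → Prop}
    (hS : ∀ ℓ, IsKolyvaginPrime N W K 2 ℓ → FrobEqFrobInfty W K (2 ^ (M + 1)) ℓ → S ℓ)
    {P₀ : (W.baseChange K).toAffine.Point} (hP₀ : IsHeegnerPoint N W K P₀)
    {ε : ℤ} (hε : ε = 1 ∨ ε = -1) (Sd : SplitDataM (PairV W c M ε) (Places K))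
    (hp : Sd.p = 2) (hEig : Sd.eig = pairEig W c M ε)
    (hA : Sd.A = pairA (N := N) W c M ε)
    (hKol : ∀ ℓ, Sd.Kol ℓ ↔ IsKolyvaginPrime N W K 2 ℓ ∧ FrobEqFrobInfty W K (2 ^ (M + 1)) ℓ ∧ S ℓ)
    {R : Type*} [AddCommGroup R] (P : Sd.Sel →+ Sd.Sel →+ R)
    (hCTV : ∀ ℓ m : ℕ, Sd.Kol ℓ → KolSupp Sd.Kol (ℓ * m) → ¬ ℓ ∣ m →
      ∀ (j N' a b : ℕ) (t : PairV W c M ε) (ht : t ∈ Sd.Sel)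
        (hz : ((Sd.p : ℤ) ^ j) • Sd.c (ℓ * m) ∈ Sd.Sel),
      ((Sd.p : ℤ) ^ N') • t = 0 → t ∈ Sd.eig (Sd.ε * (-1) ^ (ℓ * m).primeFactors.card) →
      (∀ q ∈ m.primeFactors, t ∈ Sd.A q) → Sd.M - Sd.M₀ ≤ j → N' + Sd.M₀ ≤ Sd.M → N' ≤ j →
      a + b + 1 = N' →
      ((Sd.p : ℤ) ^ (a + (j - N'))) • Sd.c m ∉ Sd.A ℓ → ((Sd.p : ℤ) ^ b) • t ∉ Sd.A ℓ →
      P ⟨_, hz⟩ ⟨t, ht⟩ ≠ 0)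
    (Zp Zm : AddSubgroup (PairV W c M ε)) [Finite Zp] [Finite Zm]
    (hZp : ∀ v ∈ Zp, v ∈ Sd.Sel ∧ v ∈ Sd.eig Sd.ε) (hZm : ∀ v ∈ Zm, v ∈ Sd.Sel ∧ v ∈ Sd.eig (-Sd.ε))
    (hiso : ∀ u, ∀ hu : u ∈ Zp ⊔ Zm, ∀ v, ∀ hv : v ∈ Zp ⊔ Zm, ∀ (hu' : u ∈ Sd.Sel) (hv' : v ∈ Sd.Sel),
      P ⟨u, hu'⟩ ⟨v, hv'⟩ = 0)
    (hind : AddSubgroup.zmultiples Sd.x ⊓ (Zp ⊔ Zm) = ⊥)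
    (hIND : (Zp ⊔ pairDelta W c M ε) ⊓ Zm = ⊥)
    (hroom : ∀ v ∈ Zp ⊔ Zm, Sd.expo v + Sd.M₀ ≤ Sd.M) :
    Nat.card Zp * Nat.card Zm ≤ 2 ^ Sd.M₀ := by
  obtain ⟨m₀, hm⟩ := exists_regular_torsion_of_Δ_neg W hK hΔ hc hc₀ (M := M + 1) (Nat.le_add_left 1 M)
  have h := card_mul_card_le_of_casselsTate_adaptive Sd P hCTV (pairDelta W c M ε)
    (fun d hd e _ hde ↦ eq_zero_of_mem_pairDelta_of_mem_pairEig W c M hε d hd e (by rw [← hEig]; exact hde))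
    (fun T g₁ g₂ ν I hν hg₁ hg₂ hT H1 H2 b ↦ by
      -- translate the binder to the pair currency and apply `cebotarev_binder_pair_succ`
      rw [hEig] at hg₁ hg₂
      have hT' : ∀ t ∈ T, ∃ e : ℤ, (e = 1 ∨ e = -1) ∧ t ∈ pairEig W c M ε e := by
        intro t ht
        obtain ⟨e, he, hte⟩ := hT t ht
        exact ⟨e, he, by rw [← hEig]; exact hte⟩
      have he₁ : addOrderOf g₁ = 2 ^ Sd.expo g₁ := by
        have h := Sd.addOrderOf_eq_pow_expo g₁
        rwa [hp] at h
      rw [hp] at H1 H2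
      have H2' : 1 ≤ I → ∀ d ∈ pairDelta W c M ε,
          ∀ u ∈ AddSubgroup.closure (T : Set (PairV W c M ε)), u ∈ pairEig W c M ε (-ν) →
          ∀ v ∈ AddSubgroup.closure (T : Set (PairV W c M ε)), v ∈ pairEig W c M ε ν →
          ((2 : ℕ) : ℤ) • v = 0 → (((2 : ℕ) : ℤ) ^ (I - 1)) • g₂ ≠ d + u + v := by
        intro hI d hd u hu huν v hv hvν h2v
        exact H2 hI d hd u hu (by rw [hEig]; exact huν) v hv (by rw [hEig]; exact hvν) h2v
      obtain ⟨ℓ, hbℓ, hkol, hpool, hfull, hge⟩ :=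
        cebotarev_binder_pair_succ W c M hC hK hρ hΔK hc hc₀ hzfix hcomm hS m₀ hm hP₀ hε T g₁ g₂ ν I
          (Sd.expo g₁) hν hg₁ hg₂ hT' he₁ H1 H2' b
      refine ⟨ℓ, hbℓ, (hKol ℓ).mpr hkol, ?_, ?_, ?_⟩
      · intro t ht
        rw [hA]
        exact hpool t ht
      · intro j hj
        rw [hp, hA]
        exact hfull j hj
      · intro i hi
        rw [hp, hA]
        exact hge i hi)
    Zp Zm hZp hZm hiso hind hIND hroom
  rwa [hp] at h

end Summit.BirchSwinnertonDyer.BirchSwinnertonDyer.Theorems.KolyvaginPairDataTwo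

end
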